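import Summits.CriticalPhenomena.PercolationContinuityZ3.Theorems.PercNearOneGluingNoHeavyLowerTailSahiFreeSlotFourMono
import Summits.CriticalPhenomena.PercolationContinuityZ3.Theorems.PercNearOneGluingNoHeavyLowerTailSahiFreeSlotFourCert
import HarnessLib

/-!
# `NoHeavyLowerTail` (stmt-CriticalPhenomena-4575) — **F(4,1)∀X: `E_4(1_X, 1_{H_A}, 1_{H_B}, 1_{H_C}) ≥ 0` for EVERY increasing event `X`,
# all finite coin sets `A, B, C` and EVERY product measure**

Support file, seat `prim-l12-p5` (gen 17), `--supports stmt-CriticalPhenomena-4575`.  COMPUTATIONAL (depends on the `native_decide` certificate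
`SahiFreeSlot.freeSlotFour_cert` of `…SahiFreeSlotFourCert`); otherwise standard axioms, no sorries, no named facts.
THE THEOREM (`SahiFreeSlot.bernoulliWeight_sahiE4_upper_hit_nonneg`): for every finite `ι`, every `p : ι → [0,1]`, every up-set `X ⊆ Set ι` and all
finite `A_0, A_1, A_2 ⊆ ι`, Sahi's fourth correlation functional of the increasing family (`1_X`, `1_{H_{A_0}}`, `1_{H_{A_1}}`, `1_{H_{A_2}}`),
`H_A = {ω | ∃ a ∈ A, a ∈ ω}`, is nonnegative under the product weight `bernoulliWeight p` — Sahi's conjecture `C_4` (Sahi 2008 Conj. 5 /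
Lieb–Sahi Conj. 1.1 at order 4) for the class "three hitting (OR) events + one ARBITRARY increasing event" of every product measure.
It contains the hitting `C_4` (`X = H_D`) and the meet row `E_4(H_A∩H_B, h,h,h) ≥ 0` (`…SahiHittingMeetFour`, `X = H_D ∩ H_E`), and it is the
merged atom of the order-5 two-slot fresh-coin cell with an arbitrary merged slot (Theorem R, `…SahiHittingFirstBernstein`).
PROOF = the free-slot region reduction (memo FROM-prim-l12-p5-g17-FREE-SLOT-REGION-REDUCTION): `E_4(f;h) = E[f·Z]` (`…SahiFreeSlotCells`), `Z` is a
function of the set of open Venn regions, the conditional free slot is monotone across the 2^7 cells (`…SahiFreeSlotFourModel`, one-coin pinning),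
Abel summation (`…SahiFreeSlotAbel`) reduces to `Σ_{R∈𝒰} z_{patt R} P_R ≥ 0` for up-sets `𝒰` of cells, and these 7-variable polynomial
inequalities reduce to 1 691 Bernstein checks (`…SahiFreeSlotFourData`, `…SahiFreeSlotFourCert`).
HONEST FRAMING: order 4; three hitting slots and one free increasing slot; product measures. [this work; cite: Sahi2008, Conj. 5; LiebSahi2021, Conj. 1.1]
-/

namespace Summit.CriticalPhenomena.PercolationContinuityZ3.Theorems

namespace SahiFreeSlot

open Literature.Combinatorics.Sahi2008
open Literature.Probability.Percolation.DecisionTree (ind)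

variable {ι : Type*} [Fintype ι] [DecidableEq ι]

/-- **F(4,1) with a free monotone slot — Sahi's `E_4 ≥ 0` for one arbitrary nonnegative increasing function and three hitting events, every
product measure.**  For every finite `ι`, `p : ι → [0,1]`, monotone `f ≥ 0` on `Set ι` and finite `A_0,A_1,A_2`:
`0 ≤ E_4(f, 1_{H_{A_0}}, 1_{H_{A_1}}, 1_{H_{A_2}})` under `bernoulliWeight p`. [this work; cite: Sahi2008, Conj. 5; LiebSahi2021, Conj. 1.1] -/
theorem bernoulliWeight_sahiE4_mono_hit_nonneg (p : ι → unitInterval) {f : Set ι → ℝ} (hf : Monotone f) (hf0 : ∀ ω, 0 ≤ f ω)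
    (A : Fin 3 → Finset ι) :
    0 ≤ sahiE (bernoulliWeight p) 4 ![f, ind {ω : Set ι | ∃ a ∈ A 0, a ∈ ω}, ind {ω : Set ι | ∃ a ∈ A 1, a ∈ ω},
      ind {ω : Set ι | ∃ a ∈ A 2, a ∈ ω}] :=
  sahiE4_mono_hit_nonneg_of_checkAll freeSlotFour_cert p hf hf0 A

/-- **F(4,1)∀X — Sahi's `E_4 ≥ 0` for one arbitrary increasing event and three hitting events, every product measure.**  For every finite `ι`,
`p : ι → [0,1]`, up-set `X` and finite `A_0,A_1,A_2`: `0 ≤ E_4(1_X, 1_{H_{A_0}}, 1_{H_{A_1}}, 1_{H_{A_2}})` under `bernoulliWeight p`.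
[this work; cite: Sahi2008, Conj. 5; LiebSahi2021, Conj. 1.1] -/
theorem bernoulliWeight_sahiE4_upper_hit_nonneg (p : ι → unitInterval) {X : Set (Set ι)} (hX : IsUpperSet X) (A : Fin 3 → Finset ι) :
    0 ≤ sahiE (bernoulliWeight p) 4 ![ind X, ind {ω : Set ι | ∃ a ∈ A 0, a ∈ ω}, ind {ω : Set ι | ∃ a ∈ A 1, a ∈ ω},
      ind {ω : Set ι | ∃ a ∈ A 2, a ∈ ω}] :=
  sahiE4_upper_hit_nonneg_of_checkAll freeSlotFour_cert p hX A

/-- The same with three separately named coin sets. [this work; cite: Sahi2008, Conj. 5] -/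
theorem bernoulliWeight_sahiE4_upper_hit3_nonneg (p : ι → unitInterval) {X : Set (Set ι)} (hX : IsUpperSet X) (A B C : Finset ι) :
    0 ≤ sahiE (bernoulliWeight p) 4 ![ind X, ind {ω : Set ι | ∃ a ∈ A, a ∈ ω}, ind {ω : Set ι | ∃ a ∈ B, a ∈ ω},
      ind {ω : Set ι | ∃ a ∈ C, a ∈ ω}] :=
  bernoulliWeight_sahiE4_upper_hit_nonneg p hX ![A, B, C]

end SahiFreeSlot

end Summit.CriticalPhenomena.PercolationContinuityZ3.Theorems
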